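import Mathlib
import Literature.Computability.AlgebraicComplexity.StandardFamilies
import HarnessLib

/-!
# Read-`k` determinantal representations and the variable size of the permanent

Topic `Computability/AlgebraicComplexity` (Valiant's classes; permanent versus determinant).

A *symbolic matrix* over `k ∪ X(σ)` is a square matrix whose entries are single variables `X e`
(`Sum.inl e`) or field elements `c` (`Sum.inr c`); it is a *determinantal representation* of
`f : MvPolynomial σ k` when the determinant of the associated matrix of polynomials equals `f`
(Aravind–Joglekar 2015; Hrubeš–Joglekar 2025, "Notation and definitions", p. 2). Its
*variable size* is the number of entries containing a variable, and it is *read-`k`* if every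
variable occurs at most `k` times (Hrubeš–Joglekar 2025, p. 2). In this setting the question is
not the SIZE of the matrix but the number of variable occurrences.

## Main definitions

* `Literature.Computability.AlgebraicComplexity.symbPoly M`: the matrix of polynomials of a
  symbolic matrix `M : Matrix m m (σ ⊕ k)` (`Sum.inl e ↦ X e`, `Sum.inr c ↦ C c`).
* `Literature.Computability.AlgebraicComplexity.IsSymbDetRepr f M`: `det (symbPoly M) = f`.
* `Literature.Computability.AlgebraicComplexity.variableSize M`: number of variable entries.
* `Literature.Computability.AlgebraicComplexity.occurrences M e`: number of entries equal to
  the variable `e`; `IsReadK M r` means every variable occurs at most `r` times.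
* Facts (as `Prop`s, to be taken as hypotheses `(h : Fact)`):
  `HrubesJoglekar2025_variableSize_perPoly` (Thm. 7: variable size `Ω(n^{5/2} / log n)` for
  `per_n`, characteristic `≠ 2`) and `HrubesJoglekar2025_readK_perPoly` (Cor. 8: read-`k`
  representations of `per_n` need `k ≥ Ω(√n / log n)`).

## Why vendored

Grounds the crux ladder of route `Summit.ValiantsHypothesis.ValiantsHypothesis.Theses.
PrincipalMinorColouring`: a principal-minor representation
`per_n(x+J) = n! · det (I_R + diag(x ∘ κ) · K)` of total rank `R` yields (block determinant with
`y = x + J` and `Kᵀ`) a symbolic determinantal representation of `per_n` of variable size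
exactly `R` in which `y_e` occurs `|κ⁻¹ e|` times, so Thm. 7 gives
`Summit.…PrincipalMinorColouring.TotalRankSuperlinear` (any `ε < 1/2`) and
`…BoundedRankImpossible`, `…RankTwoImpossible`, `…ExcessRankUnbounded` (classes `≤ r` force
`R ≤ r n²`). The dictionary itself is NOT part of this file (prover work).

## Design notes

* Counting is done with `Nat.card` of subtypes of `m × m`, avoiding decidability assumptions on
  the field `k`.
* The printed `Ω(·)` statements are rendered as `∃ c > 0, ∃ n₀, ∀ n ≥ n₀, c · g(n) ≤ ·` with the
  constant allowed to depend on the field (the printed constant is absolute; this rendering is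
  implied by the printed one). `Real.log` is the natural logarithm; the base only changes `c`.
* Statements are over an arbitrary field of characteristic `≠ 2` (`ringChar k ≠ 2`), verbatim
  the printed hypothesis; the route uses `k = ℂ`.
-/

namespace Literature.Computability.AlgebraicComplexity

open MvPolynomial Filter Asymptotics

universe u v w

section Defs

variable {k : Type u} {σ : Type v} {m : Type w}

/-- The matrix of polynomials of a *symbolic matrix* `M` over `k ∪ X(σ)`: the entry `Sum.inl e`
stands for the variable `X e`, the entry `Sum.inr c` for the constant `c`
(Hrubeš–Joglekar 2025, p. 2: "a matrix M with entries from 𝔽 ∪ X").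
[cite: HrubesJoglekar2025, §1 "Notation and definitions" (p. 2)] -/
noncomputable def symbPoly [CommSemiring k] (M : Matrix m m (σ ⊕ k)) :
    Matrix m m (MvPolynomial σ k) :=
  M.map (Sum.elim X C)

/-- `IsSymbDetRepr f M`: the symbolic matrix `M` (entries variables or field elements) is a
*determinantal representation* of `f`, i.e. `f = det M` (Hrubeš–Joglekar 2025, p. 2; the
read-`k` model of Aravind–Joglekar 2015). [cite: HrubesJoglekar2025, §1 "Notation and definitions" (p. 2)] -/
def IsSymbDetRepr [CommRing k] [Fintype m] [DecidableEq m] (f : MvPolynomial σ k)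
    (M : Matrix m m (σ ⊕ k)) : Prop :=
  (symbPoly M).det = f

/-- The *variable size* of a symbolic matrix: the number of entries containing a variable
(Hrubeš–Joglekar 2025, p. 2). [cite: HrubesJoglekar2025, §1 "Notation and definitions" (p. 2)] -/
noncomputable def variableSize (M : Matrix m m (σ ⊕ k)) : ℕ :=
  Nat.card {ij : m × m // ∃ e : σ, M ij.1 ij.2 = Sum.inl e}

/-- The number of occurrences of the variable `e` in the symbolic matrix `M`
(Hrubeš–Joglekar 2025, p. 2). [cite: HrubesJoglekar2025, §1 "Notation and definitions" (p. 2)] -/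
noncomputable def occurrences (M : Matrix m m (σ ⊕ k)) (e : σ) : ℕ :=
  Nat.card {ij : m × m // M ij.1 ij.2 = Sum.inl e}

/-- `IsReadK M r`: the symbolic matrix `M` is *read-`r`*, i.e. every variable occurs at most `r`
times in `M` (Aravind–Joglekar 2015; Hrubeš–Joglekar 2025, p. 2).
[cite: HrubesJoglekar2025, §1 "Notation and definitions" (p. 2)] -/
def IsReadK (M : Matrix m m (σ ⊕ k)) (r : ℕ) : Prop :=
  ∀ e : σ, occurrences M e ≤ r

end Defs

section Facts

/-- **Hrubeš–Joglekar 2025, Theorem 7** (as printed): "Over a field of characteristic different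
from two, every determinantal representation of `perm_n` requires variable size
`Ω(n^{5/2} / log n)`." Here a determinantal representation is a symbolic matrix `M` over
`𝔽 ∪ X` with `det M = perm_n` (`IsSymbDetRepr`), and the variable size is the number of
entries containing a variable (`variableSize`). Rendered with an explicit constant `c > 0`
(allowed to depend on the field) and threshold `n₀`; `Real.log` is the natural logarithm.
The proof in print is a Nechiporuk–Kalorkoti counting argument (Lemma 1, Thms. 2, 3).
Grounds `Summit.ValiantsHypothesis.ValiantsHypothesis.Theses.PrincipalMinorColouring.TotalRankSuperlinear`
and `…BoundedRankImpossible` via the block-determinant dictionary described in the module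
docstring. [cite: HrubesJoglekar2025, Thm. 7 (p. 5)] -/
def HrubesJoglekar2025_variableSize_perPoly : Prop :=
  ∀ (k : Type*) [Field k], ringChar k ≠ 2 →
    ∃ c : ℝ, 0 < c ∧ ∃ n₀ : ℕ, ∀ n ≥ n₀, ∀ (m : ℕ) (M : Matrix (Fin m) (Fin m) ((Fin n × Fin n) ⊕ k)),
      IsSymbDetRepr (perPoly (Fin n) k) M →
        c * (n : ℝ) ^ ((5 : ℝ) / 2) / Real.log n ≤ (variableSize M : ℝ)

/-- **Hrubeš–Joglekar 2025, Corollary 8** (as printed): "Over a field of characteristic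
different from two, every read-`k` determinantal representation of `perm_n` requires
`k ≥ Ω(√n / log n)`." (From Thm. 7: a read-`k` representation has variable size at most `n² k`.)
Rendered with an explicit constant `c > 0` and threshold `n₀`. In particular, for every fixed
`r`, `perm_n` has no read-`r` determinantal representation once `n` is large — the asymptotic
answer to the read-`k` question of Aravind–Joglekar 2015, §5.
Grounds `Summit.ValiantsHypothesis.ValiantsHypothesis.Theses.PrincipalMinorColouring.BoundedRankImpossible`
and `…RankTwoImpossible`. [cite: HrubesJoglekar2025, Cor. 8 (p. 6)] -/
def HrubesJoglekar2025_readK_perPoly : Prop :=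
  ∀ (k : Type*) [Field k], ringChar k ≠ 2 →
    ∃ c : ℝ, 0 < c ∧ ∃ n₀ : ℕ, ∀ n ≥ n₀, ∀ (r m : ℕ) (M : Matrix (Fin m) (Fin m) ((Fin n × Fin n) ⊕ k)),
      IsSymbDetRepr (perPoly (Fin n) k) M → IsReadK M r →
        c * Real.sqrt n / Real.log n ≤ (r : ℝ)

end Facts

section API

variable {k : Type u} {σ : Type v} {m : Type w}

/-- Unfolding lemma for `IsSymbDetRepr`. [cite: HrubesJoglekar2025, §1 "Notation and definitions" (p. 2)] -/
theorem isSymbDetRepr_iff [CommRing k] [Fintype m] [DecidableEq m] (f : MvPolynomial σ k)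
    (M : Matrix m m (σ ⊕ k)) : IsSymbDetRepr f M ↔ (M.map (Sum.elim X C)).det = f :=
  Iff.rfl

/-- Entries of `symbPoly`: a variable entry is sent to `X e`.
[cite: HrubesJoglekar2025, §1 "Notation and definitions" (p. 2)] -/
@[simp] theorem symbPoly_apply_inl [CommSemiring k] (M : Matrix m m (σ ⊕ k)) (i j : m) (e : σ)
    (h : M i j = Sum.inl e) : symbPoly M i j = X e := by
  simp [symbPoly, Matrix.map_apply, h]

/-- Entries of `symbPoly`: a scalar entry is sent to `C c`.
[cite: HrubesJoglekar2025, §1 "Notation and definitions" (p. 2)] -/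
@[simp] theorem symbPoly_apply_inr [CommSemiring k] (M : Matrix m m (σ ⊕ k)) (i j : m) (c : k)
    (h : M i j = Sum.inr c) : symbPoly M i j = C c := by
  simp [symbPoly, Matrix.map_apply, h]

/-- Every occurrence of a variable is a variable entry: `occurrences M e ≤ variableSize M`
(finite matrices). [cite: HrubesJoglekar2025, §1 "Notation and definitions" (p. 2)] -/
theorem occurrences_le_variableSize [Finite m] (M : Matrix m m (σ ⊕ k)) (e : σ) :
    occurrences M e ≤ variableSize M := by
  classical
  unfold occurrences variableSize
  haveI : Finite {ij : m × m // ∃ e : σ, M ij.1 ij.2 = Sum.inl e} := Subtype.finite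
  refine Nat.card_le_card_of_injective (fun x => ⟨x.1, ⟨e, x.2⟩⟩) ?_
  intro x y hxy
  have h := congrArg Subtype.val hxy
  exact Subtype.ext (by simpa using h)

/-- The arithmetic behind reading Cor. 8 at a fixed `r`: `c · √n / log n` eventually exceeds
any fixed `r` (from `log = o(x^{1/2})`, Mathlib `isLittleO_log_rpow_atTop`).
[cite: HrubesJoglekar2025, Cor. 8 (p. 6)] -/
theorem exists_nat_lt_mul_sqrt_div_log (c : ℝ) (hc : 0 < c) (r : ℕ) :
    ∃ N : ℕ, ∀ n : ℕ, N ≤ n → (r : ℝ) < c * Real.sqrt n / Real.log n := by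
  have hε : 0 < c / (r + 1) := by positivity
  have h1 := (isLittleO_log_rpow_atTop (by norm_num : (0:ℝ) < 1/2)).bound hε
  obtain ⟨N, hN⟩ := Filter.eventually_atTop.1 h1
  refine ⟨max 3 ⌈N⌉₊, fun n hn => ?_⟩
  have hn3 : (3 : ℝ) ≤ n := by exact_mod_cast le_trans (le_max_left _ _) hn
  have hnN : N ≤ (n : ℝ) :=
    le_trans (Nat.le_ceil N) (by exact_mod_cast le_trans (le_max_right _ _) hn)
  have hlogpos : 0 < Real.log n := Real.log_pos (by linarith)
  have hb := hN n hnN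
  rw [Real.norm_of_nonneg hlogpos.le, Real.norm_of_nonneg (Real.rpow_nonneg (by linarith) _)] at hb
  have hsqrt : Real.sqrt n = (n : ℝ) ^ (1/2 : ℝ) := Real.sqrt_eq_rpow _
  rw [hsqrt, lt_div_iff₀ hlogpos]
  calc (r : ℝ) * Real.log n < (r + 1) * Real.log n := by nlinarith
    _ ≤ (r + 1) * (c / (r + 1) * (n : ℝ) ^ (1/2 : ℝ)) := by gcongr
    _ = c * (n : ℝ) ^ (1/2 : ℝ) := by field_simp

/-- **Fixed-`r` reading of Hrubeš–Joglekar 2025, Cor. 8**: for every `r` there is `n₀` such that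
for `n ≥ n₀` the permanent `per_n` has NO read-`r` symbolic determinantal representation, of any
size (the asymptotic answer to Aravind–Joglekar 2015, §5; `r = 1`, `n ≥ 3` regular case:
Ikenmeyer–Landsberg 2017, Thm. 2.9). Derived here from the fact `HrubesJoglekar2025_readK_perPoly`
taken as a hypothesis. This is the shape used by
`Summit.ValiantsHypothesis.ValiantsHypothesis.Theses.PrincipalMinorColouring.BoundedRankImpossible`.
[cite: HrubesJoglekar2025, Cor. 8 (p. 6)] -/
theorem HrubesJoglekar2025_readK_perPoly.eventually_not_isReadK
    (h : HrubesJoglekar2025_readK_perPoly.{u}) (k : Type u) [Field k] (hk : ringChar k ≠ 2)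
    (r : ℕ) :
    ∃ n₀ : ℕ, ∀ n ≥ n₀, ∀ (m : ℕ) (M : Matrix (Fin m) (Fin m) ((Fin n × Fin n) ⊕ k)),
      IsSymbDetRepr (perPoly (Fin n) k) M → ¬ IsReadK M r := by
  obtain ⟨c, hc, n₀, H⟩ := h k hk
  obtain ⟨N, hN⟩ := exists_nat_lt_mul_sqrt_div_log c hc r
  refine ⟨max n₀ N, fun n hn m M hM hR => ?_⟩
  have h1 := H n (le_trans (le_max_left _ _) hn) r m M hM hR
  have h2 := hN n (le_trans (le_max_right _ _) hn)
  exact absurd h1 (not_le.mpr h2)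

end API

end Literature.Computability.AlgebraicComplexity
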